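import Literature.NumberTheory.Automorphic.ArchRankinSelbergConvergence
import Literature.NumberTheory.Automorphic.GLnCornerEmbedding
import Literature.NumberTheory.Automorphic.AdelicGLnGlueProofs
import Literature.NumberTheory.Automorphic.NormOneTorusAdelicCompact
import Literature.NumberTheory.Automorphic.MixedSpaceUnitsHaar
import Literature.NumberTheory.Automorphic.ArchimedeanDetIntegral
import HarnessLib

/-!
# The mirabolic decomposition of the archimedean Rankin–Selberg integrand (pointwise identities)

Topic `NumberTheory/Automorphic`; namespace `Literature.NumberTheory.Automorphic`. The classical proof
of the absolute convergence of `Ψ_∞(1; W, W̄, Φ)` (Jacquet–Shalika (1981), §3; Cogdell (2004), §3)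
fibres `N_n \ G_n` over `P'_n \ G_n ≅ K_∞ⁿ ∖ 0` (`P'_n = Z_n P_n`, `P_n` the mirabolic): in the
tree's Iwasawa coordinates `g = diag(y) k` (`archRankinSelbergLIntegral`, `ArchRankinSelbergConvergence`)
one writes `y = (t u, t)` with `t = y_n ∈ K_∞ˣ`, `u ∈ (K_∞ˣ)^{n-1}`, and then

* `diag(y) = diag(diag(u), 1) · (t · 1_n)` (`glDiagonal_insertNth_eq`), the scalar `t · 1_n` being
  central (`glScalar_mul_comm`);
* the last row: `e_n · diag(A, 1) g = e_n g` and `e_n (t 1_n) g = t (e_n g)` (`lastRowVec_…`);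
* the torus weight at `s = 1` factors as `|det y| δ_{B_n}(y)⁻¹ = N(t)ⁿ · δ_{B_{n-1}}(u)⁻¹`
  (`archTorusWeight_insertNth_eq`: the inner factor is `archTorusWeight (n-1) K 0 u`, the
  Iwasawa weight of `N_{n-1} \ GL_{n-1}`);
* the Gaussian `Φ_∞(e_n diag(y) k)` is bounded by `exp(-c ‖t‖²)` uniformly in `k ∈ K_n`
  (`exists_gaussArchTestFun_diag_kinf_le`: compactness of `K_n` and `e_n k ≠ 0`);
* the remaining one-variable integral is finite: `∫_{K_∞ˣ} N(t)^{m+1} e^{-c‖t‖²} d^×t < ∞`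
  (`lintegral_units_norm_rpow_mul_exp_neg_lt_top`, through `d^×t = dt / N(t)` of `MixedSpaceUnitsHaar`
  and the integrability of `(1 + ‖x‖)^{-r}`, `r > dim`, on the real vector space `K_∞`).

Everything is proved; the only definition is the auxiliary row vector `lastRowVec`. These are the
pointwise inputs of the mirabolic reduction of `archRankinSelbergLIntegral < ∞`
(`JacquetShalika1990_archRankinSelbergLIntegral_lt_top`) to the Kirillov-norm bound.

## References

* H. Jacquet, J. A. Shalika, *On Euler products and the classification of automorphic
  representations I*, Amer. J. Math. 103 (1981), §3 [JacquetShalikaAJM1981].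
* J. W. Cogdell, *Analytic theory of L-functions for GL_n* (2004), §2.2–§3.2 [CogdellAnalyticTheory2004].
-/

noncomputable section

open MeasureTheory Measure NumberField NumberField.mixedEmbedding IsDedekindDomain Set Filter
open scoped MatrixGroups ENNReal NNReal Classical Topology

namespace Literature.NumberTheory.Automorphic

variable {m : ℕ} {K : Type} [Field K] [NumberField K]

/-! ### 1. The torus point `y = (t u, t)` -/

section Torus

variable {R : Type*} [CommRing R]

/-- `diag(t u, t) = diag(diag(u), 1) · diag(t, …, t)` in `GL_{m+1}(R)`. [folklore] -/
theorem glDiagonal_insertNth_eq (t : Rˣ) (u : Fin m → Rˣ) :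
    glDiagonal (m + 1) R (Fin.insertNth (Fin.last m) t (fun i => t * u i)) =
      GLn.cornerSucc R (glDiagonal m R u) * glDiagonal (m + 1) R (fun _ => t) := by
  refine Matrix.GeneralLinearGroup.ext fun i j => ?_
  rw [Units.val_mul, Matrix.mul_apply, coe_glDiagonal, coe_glDiagonal, GLn.coe_cornerSucc]
  simp only [Matrix.diagonal_apply, coe_glDiagonal]
  rw [Finset.sum_eq_single j]
  · rcases Fin.eq_castSucc_or_eq_last i with ⟨i, rfl⟩ | rfl
    · rcases Fin.eq_castSucc_or_eq_last j with ⟨j, rfl⟩ | rfl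
      · rw [cornerSuccMatrix_apply_castSucc_castSucc, Matrix.diagonal_apply]
        by_cases hij : i = j
        · subst hij
          simp [mul_comm]
        · have : (Fin.castSucc i : Fin (m + 1)) ≠ Fin.castSucc j := fun h => hij (Fin.castSucc_injective _ h)
          simp [hij, this]
      · simp [cornerSuccMatrix_apply_castSucc_last, (Fin.castSucc_lt_last i).ne]
    · rcases Fin.eq_castSucc_or_eq_last j with ⟨j, rfl⟩ | rfl
      · simp [cornerSuccMatrix_apply_last_castSucc, (Fin.castSucc_lt_last j).ne']
      · simp [cornerSuccMatrix_apply_last_last]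
  · intro b _ hb
    simp [hb]
  · intro h; exact absurd (Finset.mem_univ j) h

/-- Scalar matrices are central: `diag(t, …, t) g = g diag(t, …, t)`. [folklore] -/
theorem glScalar_mul_comm {n : ℕ} (t : Rˣ) (g : GL (Fin n) R) :
    glDiagonal n R (fun _ => t) * g = g * glDiagonal n R (fun _ => t) := by
  refine Matrix.GeneralLinearGroup.ext fun i j => ?_
  rw [Units.val_mul, Units.val_mul, coe_glDiagonal]
  change ((Matrix.diagonal fun _ : Fin n => (t : R)) * (g : Matrix (Fin n) (Fin n) R)) i j =
    ((g : Matrix (Fin n) (Fin n) R) * Matrix.diagonal fun _ : Fin n => (t : R)) i j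
  rw [Matrix.diagonal_mul, Matrix.mul_diagonal, mul_comm]

end Torus

/-! ### 2. The last row -/

section LastRow

variable {R : Type*} [CommRing R]

/-- The row vector `e_n = (0, …, 0, 1)` of `archLastRow`, in `Fin (m+1)` indexing. [folklore] -/
theorem lastRow_indicator_eq_single :
    (fun i : Fin (m + 1) => if (i : ℕ) + 1 = m + 1 then (1 : R) else 0) =
      (Pi.single (Fin.last m) (1 : R) : Fin (m + 1) → R) := by
  funext i
  rcases Fin.eq_castSucc_or_eq_last i with ⟨i, rfl⟩ | rfl
  · rw [Pi.single_eq_of_ne (Fin.castSucc_lt_last i).ne, if_neg]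
    simp only [Fin.val_castSucc]
    have := i.2; omega
  · simp

/-- The last row `e_n g` of a matrix `g ∈ M_{m+1}(R)`. [folklore] -/
def lastRowVec (g : Matrix (Fin (m + 1)) (Fin (m + 1)) R) : Fin (m + 1) → R :=
  Matrix.vecMul (Pi.single (Fin.last m) (1 : R)) g

omit [CommRing R] in
/-- `lastRowVec g j = g_{n j}`. [folklore] -/
theorem lastRowVec_apply [CommRing R] (g : Matrix (Fin (m + 1)) (Fin (m + 1)) R) (j : Fin (m + 1)) :
    lastRowVec g j = g (Fin.last m) j := by
  rw [lastRowVec, Matrix.single_vecMul, one_smul, Matrix.row_apply]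

/-- `e_n (diag(A, 1) g) = e_n g`. [folklore] -/
theorem lastRowVec_cornerSucc_mul (A : GL (Fin m) R) (g : Matrix (Fin (m + 1)) (Fin (m + 1)) R) :
    lastRowVec (((GLn.cornerSucc R A : GL (Fin (m + 1)) R) : Matrix (Fin (m + 1)) (Fin (m + 1)) R) * g) =
      lastRowVec g := by
  rw [lastRowVec, lastRowVec, ← Matrix.vecMul_vecMul, GLn.coe_cornerSucc, single_last_vecMul_cornerSuccMatrix]

/-- `e_n (diag(t, …, t) g) = t • e_n g`. [folklore] -/
theorem lastRowVec_glScalar_mul (t : Rˣ) (g : Matrix (Fin (m + 1)) (Fin (m + 1)) R) :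
    lastRowVec (((glDiagonal (m + 1) R (fun _ => t) : GL (Fin (m + 1)) R) :
      Matrix (Fin (m + 1)) (Fin (m + 1)) R) * g) = (t : R) • lastRowVec g := by
  rw [lastRowVec, lastRowVec, ← Matrix.vecMul_vecMul, coe_glDiagonal]
  have h : Matrix.vecMul (Pi.single (Fin.last m) (1 : R)) (Matrix.diagonal fun _ : Fin (m + 1) => (t : R)) =
      (t : R) • (Pi.single (Fin.last m) (1 : R) : Fin (m + 1) → R) := by
    funext x
    rw [Matrix.vecMul_diagonal]
    rcases Fin.eq_castSucc_or_eq_last x with ⟨x, rfl⟩ | rfl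
    · simp
    · simp
  rw [h, Matrix.smul_vecMul]

/-- `e_n g ≠ 0` for invertible `g` (indeed `t • e_n g = 0` forces `t = 0`). [folklore] -/
theorem smul_lastRowVec_eq_zero_iff (t : R) (g : GL (Fin (m + 1)) R) :
    t • lastRowVec (g : Matrix (Fin (m + 1)) (Fin (m + 1)) R) = 0 ↔ t = 0 := by
  refine ⟨fun h => ?_, fun h => by rw [h, zero_smul]⟩
  have h2 : Matrix.vecMul (t • lastRowVec (g : Matrix (Fin (m + 1)) (Fin (m + 1)) R))
      ((g⁻¹ : GL (Fin (m + 1)) R) : Matrix (Fin (m + 1)) (Fin (m + 1)) R) = 0 := by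
    rw [h, Matrix.zero_vecMul]
  rw [Matrix.smul_vecMul, lastRowVec, Matrix.vecMul_vecMul, ← Units.val_mul, mul_inv_cancel,
    Units.val_one, Matrix.vecMul_one] at h2
  have h3 := congrFun h2 (Fin.last m)
  simpa using h3

variable (K) in
omit [NumberField K] in
/-- `archLastRow` is `lastRowVec` read through `K_∞ ≃ K ⊗ ℝ`. [folklore] -/
theorem archLastRow_eq (g : GL (Fin (m + 1)) (mixedSpace K)) (j : Fin (m + 1)) :
    archLastRow (m + 1) K g j =
      (InfiniteAdeleRing.ringEquiv_mixedSpace K).symm (lastRowVec (g : Matrix (Fin (m + 1)) (Fin (m + 1)) (mixedSpace K)) j) := by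
  rw [archLastRow, lastRowVec, lastRow_indicator_eq_single]

variable (K) in
/-- `Φ_∞(e_n g) = exp(-‖T(e_n g)‖²)` with `T = toEuclidean`. [folklore] -/
theorem gaussArchTestFun_archLastRow (g : GL (Fin (m + 1)) (mixedSpace K)) :
    gaussArchTestFun (m + 1) K (archLastRow (m + 1) K g) =
      Real.exp (-‖toEuclidean (E := Fin (m + 1) → mixedSpace K)
        (lastRowVec (g : Matrix (Fin (m + 1)) (Fin (m + 1)) (mixedSpace K)))‖ ^ 2) := by
  have h : (fun i => InfiniteAdeleRing.ringEquiv_mixedSpace K (archLastRow (m + 1) K g i)) =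
      lastRowVec (g : Matrix (Fin (m + 1)) (Fin (m + 1)) (mixedSpace K)) :=
    funext fun i => by rw [archLastRow_eq, RingEquiv.apply_symm_apply]
  unfold gaussArchTestFun
  rw [h]

end LastRow

/-! ### 3. The torus weight `|det y| δ_B(y)⁻¹ = N(t)ⁿ δ_{B_{n-1}}(u)⁻¹` -/

section Weight

/-- `Σ_{i<m} (1 - (m - 2 i)) = 0` (the exponents of `N(t)` on the first `m` coordinates cancel). [folklore] -/
theorem sum_torusExponent_castSucc (m : ℕ) :
    ∑ i : Fin m, ((1 : ℝ) - (((m + 1 : ℕ) : ℝ) - 1 - 2 * ((i : ℕ) : ℝ))) = 0 := by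
  have hG : (∑ i : Fin m, ((i : ℕ) : ℝ)) * 2 = (m : ℝ) * ((m : ℝ) - 1) := by
    have h := Finset.sum_range_id_mul_two m
    rw [Fin.sum_univ_eq_sum_range (fun i => ((i : ℕ) : ℝ)) m]
    rcases Nat.eq_zero_or_pos m with rfl | hm
    · simp
    · have hc : (((∑ i ∈ Finset.range m, i) * 2 : ℕ) : ℝ) = ((m * (m - 1) : ℕ) : ℝ) := by rw [h]
      push_cast [Nat.cast_sub hm] at hc
      exact hc
  have h1 : ∑ i : Fin m, ((1 : ℝ) - (((m + 1 : ℕ) : ℝ) - 1 - 2 * ((i : ℕ) : ℝ))) =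
      ∑ i : Fin m, ((1 : ℝ) - (m : ℝ) + 2 * ((i : ℕ) : ℝ)) :=
    Finset.sum_congr rfl fun i _ => by push_cast; ring
  rw [h1, Finset.sum_add_distrib, Finset.sum_const, Finset.card_univ, Fintype.card_fin, ← Finset.mul_sum,
    nsmul_eq_mul]
  linarith

/-- The exponent of the last coordinate is `1 - (m - 2m) = m + 1`. [folklore] -/
theorem torusExponent_last (m : ℕ) :
    (1 : ℝ) - (((m + 1 : ℕ) : ℝ) - 1 - 2 * ((Fin.last m : ℕ) : ℝ)) = (m : ℝ) + 1 := by
  rw [Fin.val_last]; push_cast; ring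

/-- The exponents of the Iwasawa weight of `N_{m} \ GL_m` at `s = 0` are those of the first `m`
coordinates at `s = 1` in rank `m + 1`: `0 - (m - 1 - 2i) = 1 - (m - 2i)`. [folklore] -/
theorem torusExponent_castSucc (m : ℕ) (i : Fin m) :
    (1 : ℝ) - (((m + 1 : ℕ) : ℝ) - 1 - 2 * ((Fin.castSucc i : ℕ) : ℝ)) =
      0 - ((m : ℝ) - 1 - 2 * ((i : ℕ) : ℝ)) := by
  rw [Fin.val_castSucc]; push_cast; ring

/-- **`|det y| δ_{B_{m+1}}(y)⁻¹ = N(t)^{m+1} · δ_{B_m}(u)⁻¹` for `y = (t u, t)`**: the archimedean torus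
weight at `s = 1` in rank `m + 1` is `N(t)^{m+1}` times the Iwasawa weight `archTorusWeight m K 0 u` of
`N_m \ GL_m` (Cogdell (2004), §2.2: `dg = δ_B(a)⁻¹ da dk`, `|det(t u, t)| = N(t)^{m+1} |det u|`). [folklore] -/
theorem archTorusWeight_insertNth_eq (t : (mixedSpace K)ˣ) (u : Fin m → (mixedSpace K)ˣ) :
    archTorusWeight (m + 1) K 1 (Fin.insertNth (Fin.last m) t (fun i => t * u i)) =
      mixedEmbedding.norm (t : mixedSpace K) ^ ((m : ℝ) + 1) * archTorusWeight m K 0 u := by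
  have ht0 : 0 < mixedEmbedding.norm (t : mixedSpace K) :=
    lt_of_le_of_ne (mixedEmbedding.norm_nonneg _) (norm_ne_zero_of_isUnit K t.isUnit).symm
  unfold archTorusWeight
  rw [Fin.prod_univ_castSucc]
  simp only [Fin.insertNth_last', Fin.snoc_castSucc, Fin.snoc_last, torusExponent_last, torusExponent_castSucc,
    Units.val_mul, map_mul]
  have hsplit : ∀ i : Fin m,
      (mixedEmbedding.norm (t : mixedSpace K) * mixedEmbedding.norm ((u i : (mixedSpace K)ˣ) : mixedSpace K)) ^
          ((0 : ℝ) - ((m : ℝ) - 1 - 2 * ((i : ℕ) : ℝ))) =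
        mixedEmbedding.norm (t : mixedSpace K) ^ ((0 : ℝ) - ((m : ℝ) - 1 - 2 * ((i : ℕ) : ℝ))) *
          mixedEmbedding.norm ((u i : (mixedSpace K)ˣ) : mixedSpace K) ^ ((0 : ℝ) - ((m : ℝ) - 1 - 2 * ((i : ℕ) : ℝ))) :=
    fun i => Real.mul_rpow ht0.le (mixedEmbedding.norm_nonneg _)
  simp only [hsplit, Finset.prod_mul_distrib]
  rw [← Real.rpow_sum_of_pos ht0]
  have hsum : ∑ i : Fin m, ((0 : ℝ) - ((m : ℝ) - 1 - 2 * ((i : ℕ) : ℝ))) = 0 :=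
    (Finset.sum_congr rfl fun i _ => (torusExponent_castSucc m i).symm).trans (sum_torusExponent_castSucc m)
  rw [hsum, Real.rpow_zero, one_mul, mul_comm]

end Weight

/-! ### 4. The Gaussian along the fibre: `Φ_∞(e_n diag(y) k) ≤ exp(-c ‖t‖²)` uniformly in `k ∈ K_n` -/

section Gauss

omit [NumberField K] in
/-- The last row of `diag(t u, t) k` is `t • e_n k`. [folklore] -/
theorem lastRowVec_glDiagonal_insertNth_mul (t : (mixedSpace K)ˣ) (u : Fin m → (mixedSpace K)ˣ)
    (k : GL (Fin (m + 1)) (mixedSpace K)) :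
    lastRowVec (((glDiagonal (m + 1) (mixedSpace K) (Fin.insertNth (Fin.last m) t (fun i => t * u i)) * k :
      GL (Fin (m + 1)) (mixedSpace K)) : Matrix (Fin (m + 1)) (Fin (m + 1)) (mixedSpace K))) =
      (t : mixedSpace K) • lastRowVec (k : Matrix (Fin (m + 1)) (Fin (m + 1)) (mixedSpace K)) := by
  rw [glDiagonal_insertNth_eq, mul_assoc, Units.val_mul, lastRowVec_cornerSucc_mul, Units.val_mul,
    lastRowVec_glScalar_mul]

/-- **A uniform lower bound `c ‖t‖ ≤ ‖t • e_n k‖` for `k ∈ K_n`** (`K_n` compact, `e_n k ≠ 0`, and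
`t ↦ t • e_n k` real-homogeneous). [folklore] -/
theorem exists_pos_mul_norm_le_norm_smul_lastRowVec :
    ∃ c : ℝ, 0 < c ∧ ∀ (t : mixedSpace K) (k : GL (Fin (m + 1)) (mixedSpace K)), k ∈ Kinf (m + 1) K →
      c * ‖t‖ ≤ ‖t • lastRowVec (k : Matrix (Fin (m + 1)) (Fin (m + 1)) (mixedSpace K))‖ := by
  set S : Set (mixedSpace K × GL (Fin (m + 1)) (mixedSpace K)) :=
    Metric.sphere (0 : mixedSpace K) 1 ×ˢ (Kinf (m + 1) K : Set (GL (Fin (m + 1)) (mixedSpace K))) with hS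
  have hSc : IsCompact S := (isCompact_sphere 0 1).prod (isCompact_Kinf_holds (m + 1) K)
  set f : mixedSpace K × GL (Fin (m + 1)) (mixedSpace K) → ℝ :=
    fun p => ‖p.1 • lastRowVec (p.2 : Matrix (Fin (m + 1)) (Fin (m + 1)) (mixedSpace K))‖ with hf
  have hfc : Continuous f := by
    refine continuous_norm.comp (continuous_fst.smul ?_)
    have hcoe : Continuous fun p : mixedSpace K × GL (Fin (m + 1)) (mixedSpace K) =>
        (p.2 : Matrix (Fin (m + 1)) (Fin (m + 1)) (mixedSpace K)) :=
      Units.continuous_val.comp continuous_snd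
    have heq : (fun p : mixedSpace K × GL (Fin (m + 1)) (mixedSpace K) =>
        lastRowVec (p.2 : Matrix (Fin (m + 1)) (Fin (m + 1)) (mixedSpace K))) =
        fun p j => (p.2 : Matrix (Fin (m + 1)) (Fin (m + 1)) (mixedSpace K)) (Fin.last m) j := by
      funext p j
      exact lastRowVec_apply _ _
    rw [heq]
    exact continuous_pi fun j => hcoe.matrix_elem (Fin.last m) j
  have hpos : ∀ p ∈ S, 0 < f p := by
    rintro ⟨s, k⟩ ⟨hs, -⟩
    rw [hf]
    refine norm_pos_iff.2 fun h => ?_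
    have hs0 : s = 0 := (smul_lastRowVec_eq_zero_iff s k).1 h
    rw [hs0, mem_sphere_zero_iff_norm, norm_zero] at hs
    exact zero_ne_one hs
  -- the minimum of `f` on the compact `S`
  obtain ⟨c, hc, hcle⟩ : ∃ c : ℝ, 0 < c ∧ ∀ p ∈ S, c ≤ f p := by
    rcases S.eq_empty_or_nonempty with hSe | hSn
    · exact ⟨1, one_pos, fun p hp => by rw [hSe] at hp; exact absurd hp (Set.notMem_empty p)⟩
    · obtain ⟨p₀, hp₀, hmin⟩ := hSc.exists_isMinOn hSn hfc.continuousOn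
      exact ⟨f p₀, hpos p₀ hp₀, fun p hp => hmin hp⟩
  refine ⟨c, hc, fun t k hk => ?_⟩
  rcases eq_or_ne t 0 with rfl | ht
  · simp
  · have hnt : 0 < ‖t‖ := norm_pos_iff.2 ht
    have hmem : ((‖t‖⁻¹ • t, k) : mixedSpace K × GL (Fin (m + 1)) (mixedSpace K)) ∈ S := by
      refine ⟨?_, hk⟩
      rw [mem_sphere_zero_iff_norm, _root_.norm_smul, norm_inv, norm_norm, inv_mul_cancel₀ hnt.ne']
    have h := hcle _ hmem
    simp only [hf] at h
    rw [smul_assoc, _root_.norm_smul, norm_inv, norm_norm] at h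
    rwa [le_inv_mul_iff₀ hnt, mul_comm] at h

/-- **The Gaussian factor along a mirabolic fibre decays in `t = y_n`, uniformly in `k ∈ K_n`**:
`Φ_∞(e_n diag(t u, t) k) ≤ exp(-c ‖t‖²)`. [folklore] -/
theorem exists_gaussArchTestFun_diag_kinf_le :
    ∃ c : ℝ, 0 < c ∧ ∀ (t : (mixedSpace K)ˣ) (u : Fin m → (mixedSpace K)ˣ) (k : GL (Fin (m + 1)) (mixedSpace K)),
      k ∈ Kinf (m + 1) K →
      gaussArchTestFun (m + 1) K (archLastRow (m + 1) K
        (glDiagonal (m + 1) (mixedSpace K) (Fin.insertNth (Fin.last m) t (fun i => t * u i)) * k)) ≤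
      Real.exp (-(c * ‖(t : mixedSpace K)‖ ^ 2)) := by
  obtain ⟨c₂, hc₂, hle⟩ := exists_pos_mul_norm_le_norm_smul_lastRowVec (m := m) (K := K)
  set T := toEuclidean (E := Fin (m + 1) → mixedSpace K) with hT
  set Ts : EuclideanSpace ℝ (Fin (Module.finrank ℝ (Fin (m + 1) → mixedSpace K))) →L[ℝ]
      (Fin (m + 1) → mixedSpace K) := T.symm.toContinuousLinearMap with hTs
  set C : ℝ := ‖Ts‖ with hC
  have hC0 : 0 ≤ C := norm_nonneg _
  refine ⟨(c₂ / (C + 1)) ^ 2, by positivity, fun t u k hk => ?_⟩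
  rw [gaussArchTestFun_archLastRow, lastRowVec_glDiagonal_insertNth_mul, Real.exp_le_exp, neg_le_neg_iff]
  set x : Fin (m + 1) → mixedSpace K := (t : mixedSpace K) • lastRowVec (k : Matrix (Fin (m + 1)) (Fin (m + 1)) (mixedSpace K)) with hx
  -- `‖x‖ ≤ C ‖T x‖ ≤ (C + 1) ‖T x‖`
  have h1 : ‖x‖ ≤ (C + 1) * ‖T x‖ := by
    have h := Ts.le_opNorm (T x)
    rw [hTs, ContinuousLinearEquiv.coe_coe, ContinuousLinearEquiv.symm_apply_apply] at h
    exact h.trans (mul_le_mul_of_nonneg_right (by linarith) (norm_nonneg _))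
  have h2 : c₂ * ‖(t : mixedSpace K)‖ ≤ ‖x‖ := hle _ _ hk
  have h3 : c₂ / (C + 1) * ‖(t : mixedSpace K)‖ ≤ ‖T x‖ := by
    rw [div_mul_eq_mul_div, div_le_iff₀ (by linarith)]
    linarith
  have h4 : 0 ≤ c₂ / (C + 1) * ‖(t : mixedSpace K)‖ := by positivity
  calc (c₂ / (C + 1)) ^ 2 * ‖(t : mixedSpace K)‖ ^ 2 = (c₂ / (C + 1) * ‖(t : mixedSpace K)‖) ^ 2 := by ring
    _ ≤ ‖T x‖ ^ 2 := pow_le_pow_left₀ h4 h3 2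

end Gauss

/-! ### 5. The remaining one-variable integral `∫_{K_∞ˣ} N(t)^{m+1} e^{-c‖t‖²} d^×t < ∞` -/

section OneVariable

-- `mixedEmbedding_norm_le_norm_pow` (`N(x) ≤ ‖x‖^{[K:ℚ]}`) is the tree's lemma of `ArchimedeanDetIntegral`.

/-- `(1 + r)^k e^{-c r²}` is bounded on `r ≥ 0`. [folklore] -/
theorem exists_forall_pow_mul_exp_neg_le (k : ℕ) {c : ℝ} (hc : 0 < c) :
    ∃ C : ℝ, 0 < C ∧ ∀ r : ℝ, 0 ≤ r → (1 + r) ^ k * Real.exp (-(c * r ^ 2)) ≤ C := by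
  refine ⟨2 ^ k * (1 + (k.factorial : ℝ) / c ^ k), by positivity, fun r hr => ?_⟩
  rcases le_or_gt r 1 with hr1 | hr1
  · have h1 : (1 + r) ^ k ≤ 2 ^ k := pow_le_pow_left₀ (by linarith) (by linarith) k
    have h2 : Real.exp (-(c * r ^ 2)) ≤ 1 := Real.exp_le_one_iff.2 (by nlinarith)
    calc (1 + r) ^ k * Real.exp (-(c * r ^ 2)) ≤ 2 ^ k * 1 :=
          mul_le_mul h1 h2 (Real.exp_pos _).le (by positivity)
      _ ≤ 2 ^ k * (1 + (k.factorial : ℝ) / c ^ k) := by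
          refine mul_le_mul_of_nonneg_left ?_ (by positivity)
          linarith [div_nonneg (Nat.cast_nonneg k.factorial : (0 : ℝ) ≤ k.factorial) (pow_nonneg hc.le k)]
  · -- `e^{c r²} ≥ (c r²)^k / k!` and `(1 + r)^k ≤ (2 r)^k`
    have hcr : 0 < c * r ^ 2 := by positivity
    have hexp : (c * r ^ 2) ^ k / k.factorial ≤ Real.exp (c * r ^ 2) :=
      Real.pow_div_factorial_le_exp (x := c * r ^ 2) hcr.le k
    have hfac : (0 : ℝ) < k.factorial := Nat.cast_pos.2 (Nat.factorial_pos k)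
    have hE : Real.exp (-(c * r ^ 2)) ≤ (k.factorial : ℝ) / (c * r ^ 2) ^ k := by
      rw [Real.exp_neg, inv_eq_one_div, div_le_div_iff₀ (Real.exp_pos _) (pow_pos hcr k), one_mul]
      rw [div_le_iff₀ hfac] at hexp
      linarith
    have h1 : (1 + r) ^ k ≤ (2 * r) ^ k := pow_le_pow_left₀ (by linarith) (by linarith) k
    have hrk : 1 ≤ r ^ k := one_le_pow₀ hr1.le
    calc (1 + r) ^ k * Real.exp (-(c * r ^ 2)) ≤ (2 * r) ^ k * ((k.factorial : ℝ) / (c * r ^ 2) ^ k) :=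
          mul_le_mul h1 hE (Real.exp_pos _).le (by positivity)
      _ = 2 ^ k * ((k.factorial : ℝ) / c ^ k) * (r ^ k)⁻¹ := by
          have hr0 : r ≠ 0 := by positivity
          field_simp
          ring
      _ ≤ 2 ^ k * ((k.factorial : ℝ) / c ^ k) * 1 := by
          refine mul_le_mul_of_nonneg_left (inv_le_one_of_one_le₀ hrk) (by positivity)
      _ ≤ 2 ^ k * (1 + (k.factorial : ℝ) / c ^ k) := by
          rw [mul_one]; exact mul_le_mul_of_nonneg_left (by linarith) (by positivity)

attribute [local instance] Literature.MeasureTheory.Group.Units.borelSpace_of_isOpenEmbedding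
  Literature.MeasureTheory.Group.hasSummableGeomSeries_of_finiteDimensional

/-- **`∫_{K_∞ˣ} N(t)^{m+1} e^{-c ‖t‖²} d^×t < ∞`** (`m + 1 ≥ 1`): in the coordinates `d^×t = dt / N(t)`
(`lintegral_mixedUnitsHaar`) the integrand `N(t)^m e^{-c‖t‖²} ≤ ‖t‖^{[K:ℚ] m} e^{-c‖t‖²}` is dominated
by `C (1 + ‖t‖)^{-([K:ℚ]+1)}`, integrable on the real vector space `K_∞` of dimension `[K:ℚ]`
(`finite_integral_one_add_norm`). [folklore] -/
theorem lintegral_units_norm_rpow_mul_exp_neg_lt_top {c : ℝ} (hc : 0 < c) (m : ℕ) :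
    ∫⁻ t, ENNReal.ofReal (mixedEmbedding.norm ((t : (mixedSpace K)ˣ) : mixedSpace K) ^ ((m : ℝ) + 1) *
        Real.exp (-(c * ‖((t : (mixedSpace K)ˣ) : mixedSpace K)‖ ^ 2))) ∂mixedUnitsHaar K < ⊤ := by
  set d : ℕ := Module.finrank ℚ K with hd
  set g : mixedSpace K → ℝ≥0∞ := fun x =>
    ENNReal.ofReal (mixedEmbedding.norm x ^ ((m : ℝ) + 1) * Real.exp (-(c * ‖x‖ ^ 2))) with hg
  have hgm : Measurable g := by
    refine ENNReal.measurable_ofReal.comp (Continuous.measurable ?_)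
    exact ((mixedEmbedding.continuous_norm (K := K)).rpow_const fun x => Or.inr (by positivity)).mul
      (Real.continuous_exp.comp ((continuous_const.mul (continuous_norm.pow 2)).neg))
  change ∫⁻ t, g ((t : (mixedSpace K)ˣ) : mixedSpace K) ∂mixedUnitsHaar K < ⊤
  rw [lintegral_mixedUnitsHaar K hgm]
  -- the bound `(1 + r)^k e^{-c r²} ≤ C`, `k = d m + d + 1`
  obtain ⟨C, hC, hCle⟩ := exists_forall_pow_mul_exp_neg_le (d * m + (d + 1)) hc
  have hdim : (Module.finrank ℝ (mixedSpace K) : ℝ) < (d : ℝ) + 1 := by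
    rw [mixedEmbedding.finrank, ← hd]; linarith
  have hfin := finite_integral_one_add_norm (μ := (volume : Measure (mixedSpace K))) hdim
  -- pointwise domination on units
  have hpt : ∀ x ∈ {x : mixedSpace K | IsUnit x},
      g x * (ENNReal.ofReal (mixedEmbedding.norm x))⁻¹ ≤
        ENNReal.ofReal C * ENNReal.ofReal ((1 + ‖x‖) ^ (-((d : ℝ) + 1))) := by
    intro x hx
    have hN0 : 0 < mixedEmbedding.norm x :=
      lt_of_le_of_ne (mixedEmbedding.norm_nonneg _) (norm_ne_zero_of_isUnit K hx).symm
    -- `g x / N(x) = N(x)^m e^{-c‖x‖²}`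
    have hsplit : g x * (ENNReal.ofReal (mixedEmbedding.norm x))⁻¹ =
        ENNReal.ofReal (mixedEmbedding.norm x ^ m * Real.exp (-(c * ‖x‖ ^ 2))) := by
      rw [hg]
      dsimp only
      rw [Real.rpow_add hN0, Real.rpow_one, Real.rpow_natCast,
        show mixedEmbedding.norm x ^ m * mixedEmbedding.norm x * Real.exp (-(c * ‖x‖ ^ 2)) =
          mixedEmbedding.norm x ^ m * Real.exp (-(c * ‖x‖ ^ 2)) * mixedEmbedding.norm x by ring,
        ENNReal.ofReal_mul' hN0.le, mul_assoc,
        ENNReal.mul_inv_cancel ((ENNReal.ofReal_pos.2 hN0).ne') ENNReal.ofReal_ne_top, mul_one]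
    rw [hsplit, ← ENNReal.ofReal_mul hC.le]
    refine ENNReal.ofReal_le_ofReal ?_
    -- real inequality `N^m e ≤ C (1+‖x‖)^{-(d+1)}`
    have hx0 : 0 ≤ ‖x‖ := norm_nonneg x
    have h1 : mixedEmbedding.norm x ^ m ≤ (1 + ‖x‖) ^ (d * m) := by
      calc mixedEmbedding.norm x ^ m ≤ (‖x‖ ^ d) ^ m :=
            pow_le_pow_left₀ hN0.le (mixedEmbedding_norm_le_norm_pow K x) m
        _ = ‖x‖ ^ (d * m) := by rw [pow_mul]
        _ ≤ (1 + ‖x‖) ^ (d * m) := pow_le_pow_left₀ hx0 (by linarith) _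
    have h2 := hCle ‖x‖ hx0
    have hpos : 0 < (1 + ‖x‖) ^ ((d : ℝ) + 1) := by positivity
    rw [Real.rpow_neg (by linarith), ← div_eq_mul_inv, le_div_iff₀ hpos]
    have h3 : (1 + ‖x‖) ^ ((d : ℝ) + 1) = (1 + ‖x‖) ^ (d + 1) := by
      rw [← Real.rpow_natCast]; push_cast; ring_nf
    rw [h3]
    calc mixedEmbedding.norm x ^ m * Real.exp (-(c * ‖x‖ ^ 2)) * (1 + ‖x‖) ^ (d + 1)
        ≤ (1 + ‖x‖) ^ (d * m) * Real.exp (-(c * ‖x‖ ^ 2)) * (1 + ‖x‖) ^ (d + 1) := by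
          gcongr
      _ = (1 + ‖x‖) ^ (d * m + (d + 1)) * Real.exp (-(c * ‖x‖ ^ 2)) := by rw [pow_add]; ring
      _ ≤ C := h2
  calc ∫⁻ x in {x : mixedSpace K | IsUnit x}, g x * (ENNReal.ofReal (mixedEmbedding.norm x))⁻¹ ∂volume
      ≤ ∫⁻ x in {x : mixedSpace K | IsUnit x},
          ENNReal.ofReal C * ENNReal.ofReal ((1 + ‖x‖) ^ (-((d : ℝ) + 1))) ∂volume :=
        setLIntegral_mono' Units.isOpen.measurableSet hpt
    _ ≤ ∫⁻ x, ENNReal.ofReal C * ENNReal.ofReal ((1 + ‖x‖) ^ (-((d : ℝ) + 1))) ∂volume :=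
        setLIntegral_le_lintegral _ _
    _ = ENNReal.ofReal C * ∫⁻ x, ENNReal.ofReal ((1 + ‖x‖) ^ (-((d : ℝ) + 1))) ∂volume :=
        lintegral_const_mul' _ _ ENNReal.ofReal_ne_top
    _ < ⊤ := ENNReal.mul_lt_top ENNReal.ofReal_lt_top hfin

end OneVariable

end Literature.NumberTheory.Automorphic
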